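import Summits.KontsevichZagierPeriods.KontsevichZagierPeriods.Theses.SymplecticScissors
import Literature.NumberTheory.Transcendental.KZCalculusProofs
import Literature.NumberTheory.Transcendental.KZGroundingRelations
import Literature.NumberTheory.Transcendental.KZSemiCanonicalReductionProofs
import Literature.NumberTheory.Transcendental.SemialgebraicMapsProofs

/-!
# `PlanarAreas` (stmt-KontsevichZagierPeriods-4990, route SymplecticScissors) — line
`green-native-bands`, stub `stub_areaSlicing`

**Area slicing.** An integrand-`1` representation `∫_S 1` in dimension `m + 1` (so `S` is
`ℚ`-semialgebraic of finite volume) is, modulo the KZ relations, a `ℤ`-combination of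
representations of dimension `m`; the registered stub is the planar case `m = 1`.

Proof (steps 1–3 of the tree proof `KZ.of_sub_of_mem_relations_cell` /
`KZ.of_sub_of_mem_relations_groundLast`, `Literature/NumberTheory/Transcendental/KZGroundingRelations.lean`,
stopping at the base representations instead of re-grounding): take a cylindrical decomposition
of `ℝ^m` adapted to `S` (Basu–Pollack–Roy Cor. 5.7, proved in the tree:
`IsSemialgebraic.exists_cylindricalDecomposition_holds`); cut `∫_S 1` along the cylinders over
its cells (rule (1)); over a null cell the piece is null (a relation); over a cell `C` of positive
measure every band of `S` is inner (finite volume), the piece is the almost-disjoint union of its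
open bands (the graphs are null, rule (1)), each open band is its closed band up to two null
graphs (rule (1)), and Newton–Leibniz along the last coordinate with primitive `t` (rule (3))
turns `∫_{closed band_j} 1` into the base representation `∫_C (ξ_j − ξ_{j-1})`.

Design: two general-dimension theorems (`of_sub_mem_closure_range_of_cell`, one cell;
`exists_mem_closure_range_of_sub_mem_relations`, global) and the registered planar
specialisation `stub_areaSlicing`. Only proved tree API is used; no definitions, no named facts.

## References

* M. Kontsevich, D. Zagier, *Periods* (2001), §1.2, rules (1), (3).
* S. Basu, R. Pollack, M.-F. Roy, *Algorithms in Real Algebraic Geometry* (2006), Cor. 5.7.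
-/

noncomputable section

open scoped BigOperators
open Set MeasureTheory
open Literature.NumberTheory.Transcendental
open Literature.NumberTheory.Transcendental.KZ
open Literature.ModelTheory.ExponentialFields

namespace Summit.KontsevichZagierPeriods.SymplecticScissors.PlanarAreas

/-- **Slicing over one cell.** Let `S ⊆ ℝ^{m+1}` be `ℚ`-semialgebraic of finite volume, `C` a
`ℚ`-semialgebraic cell of `ℝ^m` with `ℚ`-semialgebraic increasing sections `ξ` over which the
vertical fibres of `S` are the graphs `j ∈ G` and the bands `j ∈ B` (the output of an adapted
cylindrical decomposition), and `r = (S ∩ (C × ℝ), 1)`. Then `[r]` differs by relations from a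
`ℤ`-combination of `m`-dimensional representations: `[r]` is null if `vol C = 0`; otherwise all
bands are inner and `[S ∩ (C × ℝ)] ≡ ∑_{j ∈ B} [open band_j] ≡ ∑_j [closed band_j] ≡
∑_j [C, ξ_j − ξ_{j-1}]` by rules (1), (1), (3) — steps 1–3 of `KZ.of_sub_of_mem_relations_cell`.
[Kontsevich–Zagier 2001, §1.2, rules (1), (3)] [cite: KontsevichZagier2001, §1.2 rules (1),(3)] -/
theorem of_sub_mem_closure_range_of_cell {m l : ℕ} {S : Set (Fin (m + 1) → ℝ)}
    (hS : IsSemialgebraic ℚ S) (hfin : volume S ≠ ⊤) {C : Set (Fin m → ℝ)}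
    (hC : IsSemialgebraic ℚ C) (ξ : Fin l → (Fin m → ℝ) → ℝ)
    (hξ : ∀ i, IsSemialgebraicFunOn ℚ C (ξ i)) (hmono : ∀ x ∈ C, StrictMono fun i => ξ i x)
    (G : Finset (Fin l)) (B : Finset (Fin (l + 1))) (hBsub : ∀ j ∈ B, bandOver C ξ j ⊆ S)
    (hBsa : ∀ j, IsSemialgebraic ℚ (bandOver C ξ j))
    (hfib : ∀ x ∈ C, {t : ℝ | (Fin.snoc x t : Fin (m + 1) → ℝ) ∈ S} = (⋃ j ∈ G, {ξ j x}) ∪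
      ⋃ j ∈ B, {t : ℝ | bandLower ξ j x < (t : EReal) ∧ (t : EReal) < bandUpper ξ j x})
    (r : IntegralRep (m + 1)) (hrd : r.domain = S ∩ {z | Fin.init z ∈ C})
    (hr1 : ∀ x ∈ r.domain, r.integrand x = 1) :
    ∃ c ∈ AddSubgroup.closure (Set.range fun s : IntegralRep m => of s),
      of r - c ∈ relations := by
  classical
  have hSm : MeasurableSet S := IsSemialgebraic.measurableSet_holds hS
  have hCm : MeasurableSet C := IsSemialgebraic.measurableSet_holds hC
  by_cases hC0 : volume C = 0
  · -- the piece over a null cell is null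
    refine ⟨0, AddSubgroup.zero_mem _, ?_⟩
    rw [sub_zero]
    refine of_mem_relations_of_volume_eq_zero r ?_
    rw [hrd]
    exact measure_mono_null inter_subset_right (volume_setOf_init_mem_eq_zero (n := m) hC0)
  -- all bands over `C` are inner
  have hinner : ∀ j ∈ B, j ≠ 0 ∧ j ≠ Fin.last l := fun j hj =>
    ne_zero_and_ne_last_of_bandOver_subset hSm hfin hCm hC0 ξ (hBsub j hj)
  -- Step 1: cut `S ∩ (C × ℝ)` into its open bands
  have hOb : ∀ j : {j // j ∈ B}, ∃ Ob : IntegralRep (m + 1),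
      Ob.domain = bandOver C ξ j ∧ Ob.integrand = fun _ => 1 := fun j =>
    exists_oneRep (hBsa j) ((measure_mono (hBsub j j.2)).trans_lt hfin.lt_top).ne
  choose Ob hObd hObi using hOb
  have e1 : of r - ∑ j ∈ B.attach, of (Ob j) ∈ relations := by
    refine of_sub_sum_of_mem_relations B.attach r Ob (fun j _ => ?_) (fun j _ x hx => ?_) ?_ ?_
    · rw [hObd, hrd, show bandOver C ξ j \ (S ∩ {z | Fin.init z ∈ C}) = ∅ from
        sdiff_eq_empty.mpr fun z hz => ⟨hBsub j j.2 hz, (mem_bandOver_iff.1 hz).1⟩, measure_empty]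
    · rw [hObi, hr1 x hx.2]
    · have hsub : r.domain \ ⋃ j ∈ B.attach, (Ob j).domain ⊆
          ⋃ j ∈ G, {z : Fin (m + 1) → ℝ | Fin.init z ∈ C ∧ z (Fin.last m) = ξ j (Fin.init z)} := by
        intro z hz
        rw [hrd] at hz
        obtain ⟨⟨hzS, hzC⟩, hzU⟩ := hz
        have hzC : Fin.init z ∈ C := hzC
        have ht : z (Fin.last m) ∈ {t : ℝ | (Fin.snoc (Fin.init z) t : Fin (m + 1) → ℝ) ∈ S} := by
          show Fin.snoc (Fin.init z) (z (Fin.last m)) ∈ S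
          rw [Fin.snoc_init_self]; exact hzS
        rw [hfib _ hzC] at ht
        rcases ht with ht | ht
        · simp only [mem_iUnion, mem_singleton_iff, exists_prop] at ht
          obtain ⟨j, hj, hjt⟩ := ht
          exact mem_iUnion₂.2 ⟨j, hj, hzC, hjt⟩
        · simp only [mem_iUnion, mem_setOf_eq, exists_prop] at ht
          obtain ⟨j, hj, hjt⟩ := ht
          exact absurd (mem_iUnion₂.2 ⟨⟨j, hj⟩, Finset.mem_attach _ _, by
            rw [hObd]; exact ⟨hzC, hjt.1, hjt.2⟩⟩) hzU
      refine measure_mono_null hsub ((measure_biUnion_null_iff G.countable_toSet).2 fun j _ => ?_)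
      exact volume_graph_eq_zero (hξ j)
    · intro j _ j' _ hne
      have hne' : (j : Fin (l + 1)) ≠ j' := fun h => hne (Subtype.ext h)
      have : (Ob j).domain ∩ (Ob j').domain = ∅ := by
        rw [hObd, hObd]
        ext z
        simp only [mem_inter_iff, mem_empty_iff_false, iff_false, not_and]
        intro hz hz'
        rw [mem_bandOver_iff] at hz hz'
        exact (Set.disjoint_left.1 (disjoint_bandFibre ξ (hmono _ hz.1) hne')) ⟨hz.2.1, hz.2.2⟩
          ⟨hz'.2.1, hz'.2.2⟩
      rw [this, measure_empty]
  -- Step 2: close the bands (null modification) and go down by Newton–Leibniz (Step 3)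
  have hBb : ∀ j : {j // j ∈ B}, ∃ (Bd : IntegralRep (m + 1)) (b : IntegralRep m),
      Bd.domain = KZlog.band C (fun x => (bandLower ξ j x).toReal) (fun x => (bandUpper ξ j x).toReal) ∧
      (Bd.integrand = fun _ => 1) ∧ b.domain = C ∧
      (b.integrand = fun x => (bandUpper ξ j x).toReal - (bandLower ξ j x).toReal) ∧
      of Bd - of b ∈ newtonLeibnizRel := fun j =>
    exists_band_sub_base_mem_newtonLeibnizRel hfin hC ξ hξ hmono (hinner j j.2).1 (hinner j j.2).2
      (hBsub j j.2)
  choose Bd b hBdd hBdi _hbd _hbi hNL using hBb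
  have e2 : ∀ j : {j // j ∈ B}, of (Ob j) - of (Bd j) ∈ relations := by
    intro j
    have h0 := (hinner j j.2).1
    have hl := (hinner j j.2).2
    refine of_sub_of_mem_relations_of_null (Ob j) (Bd j) ?_ ?_ fun z _ => by rw [hObi, hBdi]
    · rw [hObd, hBdd, show bandOver C ξ j \ KZlog.band C (fun x => (bandLower ξ j x).toReal)
          (fun x => (bandUpper ξ j x).toReal) = ∅ from sdiff_eq_empty.mpr fun z hz => ?_, measure_empty]
      rw [mem_bandOver_iff, bandLower_of_ne_zero ξ j h0, bandUpper_of_ne_last ξ j hl,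
        EReal.coe_lt_coe_iff, EReal.coe_lt_coe_iff] at hz
      rw [KZlog.mem_band, bandLower_of_ne_zero ξ j h0, bandUpper_of_ne_last ξ j hl, EReal.toReal_coe,
        EReal.toReal_coe]
      exact ⟨hz.1, hz.2.1.le, hz.2.2.le⟩
    · have hlosa : IsSemialgebraicFunOn ℚ C fun x => (bandLower ξ j x).toReal :=
        (hξ (Fin.pred j h0)).congr fun x _ => by rw [bandLower_of_ne_zero ξ j h0, EReal.toReal_coe]
      have hhisa : IsSemialgebraicFunOn ℚ C fun x => (bandUpper ξ j x).toReal :=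
        (hξ (Fin.castPred j hl)).congr fun x _ => by rw [bandUpper_of_ne_last ξ j hl, EReal.toReal_coe]
      refine measure_mono_null (fun z hz => ?_)
        (measure_union_null (volume_graph_eq_zero hlosa) (volume_graph_eq_zero hhisa))
      rw [hBdd, hObd] at hz
      obtain ⟨hz, hz'⟩ := hz
      rw [KZlog.mem_band] at hz
      obtain ⟨hzC, h1, h2⟩ := hz
      rcases h1.lt_or_eq with h1 | h1
      · rcases h2.lt_or_eq with h2 | h2
        · refine absurd (mem_bandOver_iff.2 ⟨hzC, ?_, ?_⟩) hz'
          · rw [bandLower_of_ne_zero ξ j h0, EReal.coe_lt_coe_iff]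
            rwa [bandLower_of_ne_zero ξ j h0, EReal.toReal_coe] at h1
          · rw [bandUpper_of_ne_last ξ j hl, EReal.coe_lt_coe_iff]
            rwa [bandUpper_of_ne_last ξ j hl, EReal.toReal_coe] at h2
        · exact Or.inr ⟨hzC, h2⟩
      · exact Or.inl ⟨hzC, h1.symm⟩
  -- assembly: `c = ∑_j [C, ξ_j − ξ_{j-1}]`
  refine ⟨∑ j ∈ B.attach, of (b j),
    AddSubgroup.sum_mem _ fun j _ => AddSubgroup.subset_closure ⟨b j, rfl⟩, ?_⟩
  have e2' : ∑ j ∈ B.attach, of (Ob j) - ∑ j ∈ B.attach, of (Bd j) ∈ relations :=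
    sum_sub_sum_mem_relations _ _ _ fun j _ => e2 j
  have eNL : ∑ j ∈ B.attach, of (Bd j) - ∑ j ∈ B.attach, of (b j) ∈ relations :=
    sum_sub_sum_mem_relations _ _ _ fun j _ => newtonLeibnizRel_subset_relations (hNL j)
  have : of r - ∑ j ∈ B.attach, of (b j) = (of r - ∑ j ∈ B.attach, of (Ob j)) +
      (∑ j ∈ B.attach, of (Ob j) - ∑ j ∈ B.attach, of (Bd j)) +
      (∑ j ∈ B.attach, of (Bd j) - ∑ j ∈ B.attach, of (b j)) := by abel
  rw [this]
  exact relations.add_mem (relations.add_mem e1 e2') eNL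

/-- **Area slicing in dimension `m + 1`.** For a representation `r = (S, 1)` (so `S ⊆ ℝ^{m+1}` is
`ℚ`-semialgebraic of finite volume) there is a `ℤ`-combination `c` of `m`-dimensional
representations with `[r] − c ∈ relations`: cut `r` along the cylinders over the cells of a
cylindrical decomposition of `ℝ^m` adapted to `S`
(`IsSemialgebraic.exists_cylindricalDecomposition_holds`, rule (1)) and slice each piece by
`of_sub_mem_closure_range_of_cell`. [Kontsevich–Zagier 2001, §1.2, rules (1), (3);
Basu–Pollack–Roy 2006, Cor. 5.7] [cite: KontsevichZagier2001, §1.2 rules (1),(3)] -/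
theorem exists_mem_closure_range_of_sub_mem_relations {m : ℕ} (r : IntegralRep (m + 1))
    (h1 : ∀ x ∈ r.domain, r.integrand x = 1) :
    ∃ c ∈ AddSubgroup.closure (Set.range fun s : IntegralRep m => of s),
      of r - c ∈ relations := by
  classical
  have hS : IsSemialgebraic ℚ r.domain := r.isSemialgebraic_domain
  have hfin : volume r.domain ≠ ⊤ := volume_ne_top_of_integrand_one r h1
  obtain ⟨𝒮, l, ξ, hcd, -, hξ, hmono, hcells, hfib⟩ :=
    IsSemialgebraic.exists_cylindricalDecomposition.exists_fibre_eq
      (IsSemialgebraic.exists_cylindricalDecomposition_holds (k := ℚ)) hS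
  have hpart := hcd.isPartition
  have h𝒮sa := hcd.isSemialgebraic
  -- the pieces of `r` over the cells
  let R : {C // C ∈ 𝒮} → IntegralRep (m + 1) := fun C =>
    r.restrict (r.domain ∩ {z | Fin.init z ∈ (C : Set (Fin m → ℝ))})
      (hS.inter (h𝒮sa C C.2).setOf_init_mem) inter_subset_left
  have eR : of r - ∑ C ∈ 𝒮.attach, of (R C) ∈ relations :=
    of_sub_sum_cyl_mem_relations r 𝒮 hpart R (fun C => rfl) fun C x _ => rfl
  -- slice each piece
  have ecell : ∀ C : {C // C ∈ 𝒮}, ∃ c ∈ AddSubgroup.closure (Set.range fun s : IntegralRep m => of s),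
      of (R C) - c ∈ relations := by
    intro C
    obtain ⟨G, B, -, hBsub, hfibC⟩ := hfib C C.2
    exact of_sub_mem_closure_range_of_cell hS hfin (h𝒮sa C C.2) (ξ C) (hξ C C.2) (hmono C C.2) G B
      hBsub (hcells C C.2).2 hfibC (R C) rfl fun x hx => h1 x hx.1
  choose c hc hRc using ecell
  refine ⟨∑ C ∈ 𝒮.attach, c C, AddSubgroup.sum_mem _ fun C _ => hc C, ?_⟩
  have esum : ∑ C ∈ 𝒮.attach, of (R C) - ∑ C ∈ 𝒮.attach, c C ∈ relations :=
    sum_sub_sum_mem_relations _ _ _ fun C _ => hRc C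
  have : of r - ∑ C ∈ 𝒮.attach, c C = (of r - ∑ C ∈ 𝒮.attach, of (R C)) +
      (∑ C ∈ 𝒮.attach, of (R C) - ∑ C ∈ 𝒮.attach, c C) := by abel
  rw [this]
  exact relations.add_mem eR esum

/-- **Area slicing** (registered stub `stub_areaSlicing` of crux stmt-KontsevichZagierPeriods-4990).
An integrand-`1` planar representation is, modulo `KZ.relations`, a `ℤ`-combination of
1-dimensional representations: cut along the cylinders of a `ℚ`-cylindrical decomposition
adapted to the domain (rule 1a), discard null cells, and go down each inner band by
Newton–Leibniz with primitive `y` (rule 3) — the planar case `m = 1` of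
`exists_mem_closure_range_of_sub_mem_relations`. [Kontsevich–Zagier 2001, §1.2, rules (1), (3);
Basu–Pollack–Roy 2006, Cor. 5.7] [cite: KontsevichZagier2001, §1.2 rules (1),(3)] -/
theorem stub_areaSlicing : ∀ r : KZ.IntegralRep 2, (∀ p ∈ r.domain, r.integrand p = 1) →
    ∃ c ∈ AddSubgroup.closure (Set.range fun s : KZ.IntegralRep 1 => KZ.of s),
      KZ.of r - c ∈ KZ.relations :=
  fun r hr => exists_mem_closure_range_of_sub_mem_relations (m := 1) r hr

end Summit.KontsevichZagierPeriods.SymplecticScissors.PlanarAreas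

end
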